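import Literature.NumberTheory.Rogawski1990.DepthZeroKappaTransferLeviCore      -- ★ (O5-core) F0P3-p02 (g15): `finsum_delta_mul_classOrbitalIntegral_eq_of_levi_of_orbital_eq`
import Literature.NumberTheory.Rogawski1990.LeviNearOneTwoDeep                 -- ★ p846644 (O1″) p04 (g17): `exists_nhds_one_forall_levi_twoDeep`, `valued_lt_one_of_le_exp_neg_two`
import Literature.NumberTheory.Automorphic.TorusTwoDeepLevelTwoStrata            -- ★ p846625 (O2″) F0P3-p02 (g15): `classOrbitalIntegral_eq_mul_levelTwoStrata_of_torus_twoDeep`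
import Literature.NumberTheory.Rogawski1990.UnitFundamentalLemmaInertFlickerFrame    -- ★ `isUnit_two_integer_iff_valued_eq_one` (`2 ∈ 𝒪_w^×` ↔ `|2|_w = 1`)
import HarnessLib

/-!
# LIFT — the level-two LEVI ROW `stub_liftLevi` as a corollary of the (O5-core) (road «S3-tree», payable `localTransferAtOne_of_hyperspecialLevel_le_two`)

Topic `NumberTheory/Rogawski1990`; namespace `Literature.NumberTheory.Rogawski1990`.  THEOREMS ONLY (no definition, no instance, no notation, no named fact, no `sorry`);
kernel lane `--supports stmt-HodgeConjecture-24833`.  Cell `pub/hodgecm-mathlib`, crux H413; road «S3-tree» (architect A-p16 (g30) A-105 ∕ A-109 ∕ A-149 (1) ∕ A-162), END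
F0P3a-p03 (g16) fold `LocalTransferAtOneHyperspecialLevelTwo` v3.6 1254678bb0554b45, socket **(L) `stub_liftLevi` :605** (`:= liftLevi_of_organs …`, positional, binders VERBATIM).
Seat F0P3-p03 (g14).  HONEST LABEL: HC_CM is proved only modulo the cell's 2 remaining named inputs (hLiu418 24832, h413 24833) until rung 0 closes; this file asserts nothing
printed — it is a one-screen assembly of ★ organs.

THE STATEMENT (`liftLevi_of_organs` = (L) VERBATIM).  `v` non-split unramified in the CM field `L`, `v ∤ 2`, `H′` of good reduction at `w`, `μ` unramified under the N7 guard,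
canonical orbital-measure families; `g ∈ C_c^∞(U(H′)(L⁺_v))` a LEVEL-2 `K`-class piece (supported in `K`, `Ad K`-invariant, left-invariant under the level-2 congruence set
`hg2`) with its five values: boundary `c 1, c 2` (`c 0 = 0`, organ (V)-BD ★ p846587) and interior `c′ 0, c′ 1, c′ 2` (organ (V)-INT ★ p846617).  Then near `1 ∈ H_v`, at
LEVI-type `G`-regular `γ_H`:  `Σᶠ_c Δ‴_v(γ_H, c)·Φ(c, g) = a₀·Φ^st(γ_H, χ₀) + a₁·Φ^st(γ_H, χ₁)` with A-105's coefficients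
`a₀ = A₀(c) + q⁻²A₀(c′)`, `a₁ = A₁(c) + q⁻²(−q⁻¹A₀(c′) + q⁻¹A₁(c′))`, `A₀(c) = (ν_G(K)∕ν_H(K_H))(q⁻²c 0 + (q²−1)q⁻²c 1)`, `A₁(c) = (ν_G(K)∕ν_H(K_H))(−q⁻¹c 1 + (q+1)q⁻¹c 2)`.

THE PROOF.  (O5-core) ★ `finsum_delta_mul_classOrbitalIntegral_eq_of_levi_of_orbital_eq` (F0P3-p02 (g15)) reduces the Levi row of ANY Borel `Ad K`-invariant `g` to the
`G`-side VALUE `Φ(⟦ψ⁻¹ t⟧, g) = ν_G(K)·J₃(t)·X` at the `deep` regular split-torus classes and the scalar test `a₀ + (q−1)a₁ = (ν_G(K)∕ν_H(K_H))·q·X`.  Here `deep :=` 2-DEEP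
(`|d_{k,w} − 1| ≤ |ϖ_w|²`), which holds near `1` by (O1″) ★ p846644 `exists_nhds_one_forall_levi_twoDeep` and implies 1-deep (`valued_lt_one_of_le_exp_neg_two`); the value is
(O2″) ★ p846625 `classOrbitalIntegral_eq_mul_levelTwoStrata_of_torus_twoDeep`:
`X = c 2(1−q⁻²) + c 1·q⁻²(1−q⁻¹) + q⁻³(c′ 2(1−q⁻²) + c′ 1·q⁻²(1−q⁻¹) + c′ 0·q⁻³)`; and the scalar test is A-105's identity (`c 0 = 0`; `field_simp; ring`).

## References
* [Rogawski1990] J. D. Rogawski, *Automorphic Representations of Unitary Groups in Three Variables*, Ann. of Math. Stud. 123 (1990): §4.9 Prop. 4.9.1 (a)(b) pp. 54–56;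
  §4.3 (4.3.1)–(4.3.2) p. 43; §8.1 Prop. 8.1.1 p. 112.
* [Kottwitz1986] R. Kottwitz, *Base change for unit elements of Hecke algebras*, Compositio Math. 60 (1986): §3.
* [DeitmarEchterhoff2014] A. Deitmar, S. Echterhoff, *Principles of Harmonic Analysis*, 2nd ed. (2014): §1.5.
-/

set_option autoImplicit false

noncomputable section

open MeasureTheory Measure Set Function NumberField IsDedekindDomain Matrix Polynomial Topology Filter
open Literature.NumberTheory.Automorphic Literature.NumberTheory.Automorphic.UnitaryGroup
open Literature.NumberTheory.Automorphic.IntegralReduction Literature.NumberTheory.GaloisRepresentations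
open scoped Matrix MatrixGroups ValuativeRel

namespace Literature.NumberTheory.Rogawski1990

/-! ## The assembly -/

set_option maxHeartbeats 800000 in
open scoped Classical in
/-- **ORGAN (L) «LIFT — THE LEVEL-2 LEVI ROW» — over the (O5-core)** (see the module docstring; binders VERBATIM = END v3.6 `stub_liftLevi`).
[cite: Rogawski1990, §4.9 Prop. 4.9.1 (a) p. 55; §4.3 (4.3.1)–(4.3.2) p. 43; §8.1 Prop. 8.1.1 p. 112] [cite: Kottwitz1986, §3] [cite: DeitmarEchterhoff2014, §1.5] -/
theorem liftLevi_of_organs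
    (L : Type) [Field L] [NumberField L] [IsCMField L] (H' : Matrix (Fin 3) (Fin 3) L) (μ : HeckeCharacter L)
    {v : HeightOneSpectrum (𝓞 ↥(maximalRealSubfield L))}
    (hH' : (H'.map (cmConjRingHom L)).transpose = H') (w : PlacesOver L v)
    (hw : IsCMField.complexConj L • w.1 = w.1) (hv : Algebra.IsUnramifiedIn (𝓞 L) v.asIdeal)
    (hH'w : IsUnit (placeForm H' w.1)) (hH'i : hH'w.unit ∈ glInt 3 (w.1.adicCompletion L))
    (hμ : μ.IsUnramifiedAt w.1) (hμu : μ.IsUnitary)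
    (hμω : ∀ x : ideleGroup ↥(maximalRealSubfield L), μ (AdeleRing.ideleBaseChange ↥(maximalRealSubfield L) L x) = quadraticHeckeCharCM L x)
    (h2 : IsUnit (2 : 𝒪[w.1.adicCompletion L]))
    [MeasurableSpace ((cmDatum L 3 H').Local v)] [BorelSpace ((cmDatum L 3 H').Local v)]
    [∀ γ : ((cmDatum L 3 H').Local v), MeasurableSpace (((cmDatum L 3 H').Local v) ⧸ Subgroup.centralizer ({γ} : Set ((cmDatum L 3 H').Local v)))]
    [∀ γ : ((cmDatum L 3 H').Local v), BorelSpace (((cmDatum L 3 H').Local v) ⧸ Subgroup.centralizer ({γ} : Set ((cmDatum L 3 H').Local v)))]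
    [MeasurableSpace ((cmDatum L 2 (Matrix.of fun i j : Fin 2 => if i.val + j.val + 1 = 2 then (1 : L) else 0)).Local v × (cmDatum L 1 (Matrix.of fun i j : Fin 1 => if i.val + j.val + 1 = 1 then (1 : L) else 0)).Local v)] [BorelSpace ((cmDatum L 2 (Matrix.of fun i j : Fin 2 => if i.val + j.val + 1 = 2 then (1 : L) else 0)).Local v × (cmDatum L 1 (Matrix.of fun i j : Fin 1 => if i.val + j.val + 1 = 1 then (1 : L) else 0)).Local v)]
  [∀ a : (cmDatum L 2 (Matrix.of fun i j : Fin 2 => if i.val + j.val + 1 = 2 then (1 : L) else 0)).Local v × (cmDatum L 1 (Matrix.of fun i j : Fin 1 => if i.val + j.val + 1 = 1 then (1 : L) else 0)).Local v, MeasurableSpace (((cmDatum L 2 (Matrix.of fun i j : Fin 2 => if i.val + j.val + 1 = 2 then (1 : L) else 0)).Local v × (cmDatum L 1 (Matrix.of fun i j : Fin 1 => if i.val + j.val + 1 = 1 then (1 : L) else 0)).Local v) ⧸ Subgroup.centralizer ({a} : Set ((cmDatum L 2 (Matrix.of fun i j : Fin 2 => if i.val + j.val + 1 = 2 then (1 :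 L) else 0)).Local v × (cmDatum L 1 (Matrix.of fun i j : Fin 1 => if i.val + j.val + 1 = 1 then (1 : L) else 0)).Local v)))]
  [∀ a : (cmDatum L 2 (Matrix.of fun i j : Fin 2 => if i.val + j.val + 1 = 2 then (1 : L) else 0)).Local v × (cmDatum L 1 (Matrix.of fun i j : Fin 1 => if i.val + j.val + 1 = 1 then (1 : L) else 0)).Local v, BorelSpace (((cmDatum L 2 (Matrix.of fun i j : Fin 2 => if i.val + j.val + 1 = 2 then (1 : L) else 0)).Local v × (cmDatum L 1 (Matrix.of fun i j : Fin 1 => if i.val + j.val + 1 = 1 then (1 : L) else 0)).Local v) ⧸ Subgroup.centralizer ({a} : Set ((cmDatum L 2 (Matrix.of fun i j : Fin 2 => if i.val + j.val + 1 = 2 then (1 : L) else 0)).Local v × (cmDatum L 1 (Matrix.of fun i j : Fin 1 => if i.val + j.val + 1 = 1 then (1 : L) else 0)).Local v)))]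
    (νH : Measure ((cmDatum L 2 (Matrix.of fun i j : Fin 2 => if i.val + j.val + 1 = 2 then (1 : L) else 0)).Local v × (cmDatum L 1 (Matrix.of fun i j : Fin 1 => if i.val + j.val + 1 = 1 then (1 : L) else 0)).Local v)) [νH.IsHaarMeasure] [νH.IsMulRightInvariant]
    (νG : Measure ((cmDatum L 3 H').Local v)) [νG.IsHaarMeasure] [νG.IsMulRightInvariant]
    {mH : OrbitalMeasureFamily ((cmDatum L 2 (Matrix.of fun i j : Fin 2 => if i.val + j.val + 1 = 2 then (1 : L) else 0)).Local v × (cmDatum L 1 (Matrix.of fun i j : Fin 1 => if i.val + j.val + 1 = 1 then (1 : L) else 0)).Local v)} {mG : OrbitalMeasureFamily ((cmDatum L 3 H').Local v)}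
    (hmH : mH.IsCanonical (IsLocalGRegular L v) νH)
    (hmG : mG.IsCanonical (fun γ => IsRegularElt (γ.val : GL (Fin 3) (UnitaryGroup.LocalRing L v))) νG)
    (g : ((cmDatum L 3 H').Local v) → ℂ) (hg : IsLocSmooth g) (hgK : tsupport g ⊆ (cmLocalIntegralLevel L 3 H' v : Set ((cmDatum L 3 H').Local v)))
    (hginv : ∀ u ∈ cmLocalIntegralLevel L 3 H' v, ∀ x, g (u * x * u⁻¹) = g x)
    (hg2 : ∀ u : (cmDatum L 3 H').Local v,
      (∀ a b, Valued.v (((toPlace v w (HeckeCharacter.uniformizer ↥(maximalRealSubfield L) v : v.adicCompletion ↥(maximalRealSubfield L))) ^ 2)⁻¹ *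
        ((((localNonsplitEquiv (IsCMField.complexConj L) H' (IsCMField.complexConj_ne_one L) w hw u :
            ↥(unitaryGroupOfForm (galAdicCompletionMap (L := L) (IsCMField.complexConj L) hw) (placeForm H' w.1))) : GL (Fin 3) (w.1.adicCompletion L)) :
              Matrix (Fin 3) (Fin 3) (w.1.adicCompletion L)) a b - (1 : Matrix (Fin 3) (Fin 3) (w.1.adicCompletion L)) a b)) ≤ 1) →
      ∀ x, g (u * x) = g x)
    (c c' : ℕ → ℂ) (hc : (c 0 = 0 ∧ (∀ x : ((cmDatum L 3 H').Local v), (x ∈ cmLocalIntegralLevel L 3 H' v ∧ (redMat (((x).val : GL (Fin 3) (UnitaryGroup.LocalRing L v)).val.map (Pi.evalRingHom (fun w' : PlacesOver L v => w'.1.adicCompletion L) w)) - 1) ^ 3 = 0 ∧ (redMat (((x).val : GL (Fin 3) (UnitaryGroup.LocalRing L v)).val.map (Pi.evalRingHom (fun w' : PlacesOver L v => w'.1.adicCompletion L) w)) - 1).rank = 1 ∧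
        ∃ y : ((cmDatum L 3 H').Local v), (∀ a b, Valued.v (((toPlace v w (HeckeCharacter.uniformizer ↥(maximalRealSubfield L) v : v.adicCompletion ↥(maximalRealSubfield L))) ^ 2)⁻¹ *
        ((((localNonsplitEquiv (IsCMField.complexConj L) H' (IsCMField.complexConj_ne_one L) w hw (y * x * y⁻¹) :
            ↥(unitaryGroupOfForm (galAdicCompletionMap (L := L) (IsCMField.complexConj L) hw) (placeForm H' w.1))) : GL (Fin 3) (w.1.adicCompletion L)) :
              Matrix (Fin 3) (Fin 3) (w.1.adicCompletion L)) a b - (1 : Matrix (Fin 3) (Fin 3) (w.1.adicCompletion L)) a b)) ≤ 1)) → g x = c 1) ∧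
      (∀ x : ((cmDatum L 3 H').Local v), (x ∈ cmLocalIntegralLevel L 3 H' v ∧ (redMat (((x).val : GL (Fin 3) (UnitaryGroup.LocalRing L v)).val.map (Pi.evalRingHom (fun w' : PlacesOver L v => w'.1.adicCompletion L) w)) - 1) ^ 3 = 0 ∧ (redMat (((x).val : GL (Fin 3) (UnitaryGroup.LocalRing L v)).val.map (Pi.evalRingHom (fun w' : PlacesOver L v => w'.1.adicCompletion L) w)) - 1).rank = 2 ∧
        ∃ y : ((cmDatum L 3 H').Local v), (∀ a b, Valued.v (((toPlace v w (HeckeCharacter.uniformizer ↥(maximalRealSubfield L) v : v.adicCompletion ↥(maximalRealSubfield L))) ^ 2)⁻¹ *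
        ((((localNonsplitEquiv (IsCMField.complexConj L) H' (IsCMField.complexConj_ne_one L) w hw (y * x * y⁻¹) :
            ↥(unitaryGroupOfForm (galAdicCompletionMap (L := L) (IsCMField.complexConj L) hw) (placeForm H' w.1))) : GL (Fin 3) (w.1.adicCompletion L)) :
              Matrix (Fin 3) (Fin 3) (w.1.adicCompletion L)) a b - (1 : Matrix (Fin 3) (Fin 3) (w.1.adicCompletion L)) a b)) ≤ 1)) → g x = c 2)))
    (hc' : ((∀ x : ((cmDatum L 3 H').Local v), (x ∈ cmLocalIntegralLevel L 3 H' v ∧ (∀ a b, Valued.v (((toPlace v w (HeckeCharacter.uniformizer ↥(maximalRealSubfield L) v : v.adicCompletion ↥(maximalRealSubfield L))) ^ 1)⁻¹ *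
        ((((localNonsplitEquiv (IsCMField.complexConj L) H' (IsCMField.complexConj_ne_one L) w hw (x) :
            ↥(unitaryGroupOfForm (galAdicCompletionMap (L := L) (IsCMField.complexConj L) hw) (placeForm H' w.1))) : GL (Fin 3) (w.1.adicCompletion L)) :
              Matrix (Fin 3) (Fin 3) (w.1.adicCompletion L)) a b - (1 : Matrix (Fin 3) (Fin 3) (w.1.adicCompletion L)) a b)) ≤ 1) ∧
        (redMat ((toPlace v w (HeckeCharacter.uniformizer ↥(maximalRealSubfield L) v : v.adicCompletion ↥(maximalRealSubfield L)))⁻¹ • ((((x).val : GL (Fin 3) (UnitaryGroup.LocalRing L v)).val.map (Pi.evalRingHom (fun w' : PlacesOver L v => w'.1.adicCompletion L) w)) - 1))) ^ 3 = 0 ∧ (redMat ((toPlace v w (HeckeCharacter.uniformizer ↥(maximalRealSubfield L) v : v.adicCompletion ↥(maximalRealSubfield L)))⁻¹ • ((((x).val : GL (Fin 3) (UnitaryGroup.LocalRing L v)).val.map (Pi.evalRingHom (fun w' : PlacesOver L v => w'.1.adicCompletion L) w)) - 1))).rank = 0) → g x = c' 0) ∧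
      (∀ x : ((cmDatum L 3 H').Local v), (x ∈ cmLocalIntegralLevel L 3 H' v ∧ (∀ a b, Valued.v (((toPlace v w (HeckeCharacter.uniformizer ↥(maximalRealSubfield L) v : v.adicCompletion ↥(maximalRealSubfield L))) ^ 1)⁻¹ *
        ((((localNonsplitEquiv (IsCMField.complexConj L) H' (IsCMField.complexConj_ne_one L) w hw (x) :
            ↥(unitaryGroupOfForm (galAdicCompletionMap (L := L) (IsCMField.complexConj L) hw) (placeForm H' w.1))) : GL (Fin 3) (w.1.adicCompletion L)) :
              Matrix (Fin 3) (Fin 3) (w.1.adicCompletion L)) a b - (1 : Matrix (Fin 3) (Fin 3) (w.1.adicCompletion L)) a b)) ≤ 1) ∧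
        (redMat ((toPlace v w (HeckeCharacter.uniformizer ↥(maximalRealSubfield L) v : v.adicCompletion ↥(maximalRealSubfield L)))⁻¹ • ((((x).val : GL (Fin 3) (UnitaryGroup.LocalRing L v)).val.map (Pi.evalRingHom (fun w' : PlacesOver L v => w'.1.adicCompletion L) w)) - 1))) ^ 3 = 0 ∧ (redMat ((toPlace v w (HeckeCharacter.uniformizer ↥(maximalRealSubfield L) v : v.adicCompletion ↥(maximalRealSubfield L)))⁻¹ • ((((x).val : GL (Fin 3) (UnitaryGroup.LocalRing L v)).val.map (Pi.evalRingHom (fun w' : PlacesOver L v => w'.1.adicCompletion L) w)) - 1))).rank = 1) → g x = c' 1) ∧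
      (∀ x : ((cmDatum L 3 H').Local v), (x ∈ cmLocalIntegralLevel L 3 H' v ∧ (∀ a b, Valued.v (((toPlace v w (HeckeCharacter.uniformizer ↥(maximalRealSubfield L) v : v.adicCompletion ↥(maximalRealSubfield L))) ^ 1)⁻¹ *
        ((((localNonsplitEquiv (IsCMField.complexConj L) H' (IsCMField.complexConj_ne_one L) w hw (x) :
            ↥(unitaryGroupOfForm (galAdicCompletionMap (L := L) (IsCMField.complexConj L) hw) (placeForm H' w.1))) : GL (Fin 3) (w.1.adicCompletion L)) :
              Matrix (Fin 3) (Fin 3) (w.1.adicCompletion L)) a b - (1 : Matrix (Fin 3) (Fin 3) (w.1.adicCompletion L)) a b)) ≤ 1) ∧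
        (redMat ((toPlace v w (HeckeCharacter.uniformizer ↥(maximalRealSubfield L) v : v.adicCompletion ↥(maximalRealSubfield L)))⁻¹ • ((((x).val : GL (Fin 3) (UnitaryGroup.LocalRing L v)).val.map (Pi.evalRingHom (fun w' : PlacesOver L v => w'.1.adicCompletion L) w)) - 1))) ^ 3 = 0 ∧ (redMat ((toPlace v w (HeckeCharacter.uniformizer ↥(maximalRealSubfield L) v : v.adicCompletion ↥(maximalRealSubfield L)))⁻¹ • ((((x).val : GL (Fin 3) (UnitaryGroup.LocalRing L v)).val.map (Pi.evalRingHom (fun w' : PlacesOver L v => w'.1.adicCompletion L) w)) - 1))).rank = 2) → g x = c' 2))) :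
    ∃ V ∈ 𝓝 (1 : ((cmDatum L 2 (Matrix.of fun i j : Fin 2 => if i.val + j.val + 1 = 2 then (1 : L) else 0)).Local v × (cmDatum L 1 (Matrix.of fun i j : Fin 1 => if i.val + j.val + 1 = 1 then (1 : L) else 0)).Local v)), ∀ γH ∈ V, IsLocalGRegular L v γH →
      (∃ (y : ((cmDatum L 2 (Matrix.of fun i j : Fin 2 => if i.val + j.val + 1 = 2 then (1 : L) else 0)).Local v × (cmDatum L 1 (Matrix.of fun i j : Fin 1 => if i.val + j.val + 1 = 1 then (1 : L) else 0)).Local v)) (d' : Fin 2 → (UnitaryGroup.LocalRing L v)ˣ),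
          glDiagonal 2 (UnitaryGroup.LocalRing L v) d' = ((y * γH * y⁻¹).1.val : GL (Fin 2) (UnitaryGroup.LocalRing L v))) →
      (∑ᶠ cG : ConjClasses ((cmDatum L 3 H').Local v),
            ((finExplicitCollection L H' μ (finExplicitDelta_conj_left_all L H' μ) (finExplicitDelta_conj_right_all L H' μ)) v).Δ γH (Quotient.out cG) *
              classOrbitalIntegral mG g cG) =
        (((νG.real (cmLocalIntegralLevel L 3 H' v : Set ((cmDatum L 3 H').Local v)) / νH.real (((cmLocalIntegralLevel L 2 (Matrix.of fun i j : Fin 2 => if i.val + j.val + 1 = 2 then (1 : L) else 0) v).prod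
                (cmLocalIntegralLevel L 1 (Matrix.of fun i j : Fin 1 => if i.val + j.val + 1 = 1 then (1 : L) else 0) v) : Subgroup _) : Set _) : ℝ) : ℂ) * ((((Ideal.absNorm v.asIdeal : ℂ) ^ 2)⁻¹ * c 0 + (((Ideal.absNorm v.asIdeal : ℂ) ^ 2 - 1) / (Ideal.absNorm v.asIdeal : ℂ) ^ 2) * c 1)) +
          (((Ideal.absNorm v.asIdeal : ℕ) : ℂ) ^ 2)⁻¹ * (((νG.real (cmLocalIntegralLevel L 3 H' v : Set ((cmDatum L 3 H').Local v)) / νH.real (((cmLocalIntegralLevel L 2 (Matrix.of fun i j : Fin 2 => if i.val + j.val + 1 = 2 then (1 : L) else 0) v).prod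
                (cmLocalIntegralLevel L 1 (Matrix.of fun i j : Fin 1 => if i.val + j.val + 1 = 1 then (1 : L) else 0) v) : Subgroup _) : Set _) : ℝ) : ℂ) * ((((Ideal.absNorm v.asIdeal : ℂ) ^ 2)⁻¹ * c' 0 + (((Ideal.absNorm v.asIdeal : ℂ) ^ 2 - 1) / (Ideal.absNorm v.asIdeal : ℂ) ^ 2) * c' 1)))) * stableOrbitalIntegralRel (IsLocalStablyConjH L v) mH (((((cmLocalIntegralLevel L 2 (Matrix.of fun i j : Fin 2 => if i.val + j.val + 1 = 2 then (1 : L) else 0) v).prod (cmLocalIntegralLevel L 1 (Matrix.of fun i j : Fin 1 => if i.val + j.val + 1 = 1 then (1 : L) else 0) v)) : Subgroup ((cmDatum L 2 (Matrix.of fun i j : Fin 2 => if i.val + j.val + 1 = 2 then (1 : L) else 0)).Local v × (cmDatum L 1 (Matrix.of fun i j : Fin 1 => if i.val + j.val + 1 = 1 then (1 : L) else 0)).Local v)) : Set ((cmDatum L 2 (Matrix.of fun i j : Fin 2 => if i.val + j.val + 1 = 2 then (1 : L) else 0)).Local v × (cmDatum L 1 (Matrix.of fun i j : Fin 1 =>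 if i.val + j.val + 1 = 1 then (1 : L) else 0)).Local v)).indicator fun h => if (redMat (((h).1.val : GL (Fin 2) (UnitaryGroup.LocalRing L v)).val.map (Pi.evalRingHom (fun w' : PlacesOver L v => w'.1.adicCompletion L) w)) - 1) ^ 2 = 0 ∧ (redMat (((h).1.val : GL (Fin 2) (UnitaryGroup.LocalRing L v)).val.map (Pi.evalRingHom (fun w' : PlacesOver L v => w'.1.adicCompletion L) w)) - 1).rank = 0 then (1 : ℂ) else 0) γH +
        (((νG.real (cmLocalIntegralLevel L 3 H' v : Set ((cmDatum L 3 H').Local v)) / νH.real (((cmLocalIntegralLevel L 2 (Matrix.of fun i j : Fin 2 => if i.val + j.val + 1 = 2 then (1 : L) else 0) v).prod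
                (cmLocalIntegralLevel L 1 (Matrix.of fun i j : Fin 1 => if i.val + j.val + 1 = 1 then (1 : L) else 0) v) : Subgroup _) : Set _) : ℝ) : ℂ) * (-((Ideal.absNorm v.asIdeal : ℂ))⁻¹ * c 1 + (((Ideal.absNorm v.asIdeal : ℂ) + 1) / (Ideal.absNorm v.asIdeal : ℂ)) * c 2) +
          (((Ideal.absNorm v.asIdeal : ℕ) : ℂ) ^ 2)⁻¹ * (-((Ideal.absNorm v.asIdeal : ℕ) : ℂ)⁻¹ * (((νG.real (cmLocalIntegralLevel L 3 H' v : Set ((cmDatum L 3 H').Local v)) / νH.real (((cmLocalIntegralLevel L 2 (Matrix.of fun i j : Fin 2 => if i.val + j.val + 1 = 2 then (1 : L) else 0) v).prod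
                (cmLocalIntegralLevel L 1 (Matrix.of fun i j : Fin 1 => if i.val + j.val + 1 = 1 then (1 : L) else 0) v) : Subgroup _) : Set _) : ℝ) : ℂ) * ((((Ideal.absNorm v.asIdeal : ℂ) ^ 2)⁻¹ * c' 0 + (((Ideal.absNorm v.asIdeal : ℂ) ^ 2 - 1) / (Ideal.absNorm v.asIdeal : ℂ) ^ 2) * c' 1))) +
          ((Ideal.absNorm v.asIdeal : ℕ) : ℂ)⁻¹ * (((νG.real (cmLocalIntegralLevel L 3 H' v : Set ((cmDatum L 3 H').Local v)) / νH.real (((cmLocalIntegralLevel L 2 (Matrix.of fun i j : Fin 2 => if i.val + j.val + 1 = 2 then (1 : L) else 0) v).prod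
                (cmLocalIntegralLevel L 1 (Matrix.of fun i j : Fin 1 => if i.val + j.val + 1 = 1 then (1 : L) else 0) v) : Subgroup _) : Set _) : ℝ) : ℂ) * (-((Ideal.absNorm v.asIdeal : ℂ))⁻¹ * c' 1 + (((Ideal.absNorm v.asIdeal : ℂ) + 1) / (Ideal.absNorm v.asIdeal : ℂ)) * c' 2)))) * stableOrbitalIntegralRel (IsLocalStablyConjH L v) mH (((((cmLocalIntegralLevel L 2 (Matrix.of fun i j : Fin 2 => if i.val + j.val + 1 = 2 then (1 : L) else 0) v).prod (cmLocalIntegralLevel L 1 (Matrix.of fun i j : Fin 1 => if i.val + j.val + 1 = 1 then (1 : L) else 0) v)) : Subgroup ((cmDatum L 2 (Matrix.of fun i j : Fin 2 => if i.val + j.val + 1 = 2 then (1 : L) else 0)).Local v × (cmDatum L 1 (Matrix.of fun i j : Fin 1 => if i.val + j.val + 1 = 1 then (1 : L) else 0)).Local v)) : Set ((cmDatum L 2 (Matrix.of fun i j : Fin 2 => if i.val + j.val + 1 = 2 then (1 : L) else 0)).Local v × (cmDatum L 1 (Matrix.of fun i j : Fin 1 => if i.val + j.val + 1 = 1 then (1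 : L) else 0)).Local v)).indicator fun h => if (redMat (((h).1.val : GL (Fin 2) (UnitaryGroup.LocalRing L v)).val.map (Pi.evalRingHom (fun w' : PlacesOver L v => w'.1.adicCompletion L) w)) - 1) ^ 2 = 0 ∧ (redMat (((h).1.val : GL (Fin 2) (UnitaryGroup.LocalRing L v)).val.map (Pi.evalRingHom (fun w' : PlacesOver L v => w'.1.adicCompletion L) w)) - 1).rank = 1 then (1 : ℂ) else 0) γH := by
  have hH'σ : (H'.map (IsCMField.complexConj L))ᵀ = H' := hH'
  have hH'd : IsUnit H'.det := by
    have h := (Matrix.isUnit_iff_isUnit_det _).1 hH'w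
    rw [show placeForm H' w.1 = (algebraMap L (w.1.adicCompletion L)).mapMatrix H' from rfl, ← RingHom.map_det] at h
    exact isUnit_iff_ne_zero.2 fun h0 => h.ne_zero (by rw [h0, map_zero])
  have _hμu := hμu  -- binders of the socket text ((L) VERBATIM) not needed by the proof
  have _hg2 := hg2
  have h2w : Valued.v (2 : w.1.adicCompletion L) = 1 := (isUnit_two_integer_iff_valued_eq_one L w.1).1 h2
  have hq0 : (Ideal.absNorm v.asIdeal : ℂ) ≠ 0 := by exact_mod_cast fun h => v.ne_bot (Ideal.absNorm_eq_zero_iff.1 h)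
  have hc0 : c 0 = 0 := hc.1
  -- the coefficient test `a₀ + (q − 1)a₁ = (ν_G(K)∕ν_H(K_H))·q·X` (architect A-105's table; `c 0 = 0`)
  have ha : (((νG.real (cmLocalIntegralLevel L 3 H' v : Set ((cmDatum L 3 H').Local v)) / νH.real (((cmLocalIntegralLevel L 2 (Matrix.of fun i j : Fin 2 => if i.val + j.val + 1 = 2 then (1 : L) else 0) v).prod
                (cmLocalIntegralLevel L 1 (Matrix.of fun i j : Fin 1 => if i.val + j.val + 1 = 1 then (1 : L) else 0) v) : Subgroup _) : Set _) : ℝ) : ℂ) * ((((Ideal.absNorm v.asIdeal : ℂ) ^ 2)⁻¹ * c 0 + (((Ideal.absNorm v.asIdeal : ℂ) ^ 2 - 1) / (Ideal.absNorm v.asIdeal : ℂ) ^ 2) * c 1)) +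
          (((Ideal.absNorm v.asIdeal : ℕ) : ℂ) ^ 2)⁻¹ * (((νG.real (cmLocalIntegralLevel L 3 H' v : Set ((cmDatum L 3 H').Local v)) / νH.real (((cmLocalIntegralLevel L 2 (Matrix.of fun i j : Fin 2 => if i.val + j.val + 1 = 2 then (1 : L) else 0) v).prod
                (cmLocalIntegralLevel L 1 (Matrix.of fun i j : Fin 1 => if i.val + j.val + 1 = 1 then (1 : L) else 0) v) : Subgroup _) : Set _) : ℝ) : ℂ) * ((((Ideal.absNorm v.asIdeal : ℂ) ^ 2)⁻¹ * c' 0 + (((Ideal.absNorm v.asIdeal : ℂ) ^ 2 - 1) / (Ideal.absNorm v.asIdeal : ℂ) ^ 2) * c' 1)))) + ((Ideal.absNorm v.asIdeal : ℂ) - 1) * (((νG.real (cmLocalIntegralLevel L 3 H' v : Set ((cmDatum L 3 H').Local v)) / νH.real (((cmLocalIntegralLevel L 2 (Matrix.of fun i j : Fin 2 => if i.val + j.val + 1 = 2 then (1 : L) else 0) v).prod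
                (cmLocalIntegralLevel L 1 (Matrix.of fun i j : Fin 1 => if i.val + j.val + 1 = 1 then (1 : L) else 0) v) : Subgroup _) : Set _) : ℝ) : ℂ) * (-((Ideal.absNorm v.asIdeal : ℂ))⁻¹ * c 1 + (((Ideal.absNorm v.asIdeal : ℂ) + 1) / (Ideal.absNorm v.asIdeal : ℂ)) * c 2) +
          (((Ideal.absNorm v.asIdeal : ℕ) : ℂ) ^ 2)⁻¹ * (-((Ideal.absNorm v.asIdeal : ℕ) : ℂ)⁻¹ * (((νG.real (cmLocalIntegralLevel L 3 H' v : Set ((cmDatum L 3 H').Local v)) / νH.real (((cmLocalIntegralLevel L 2 (Matrix.of fun i j : Fin 2 => if i.val + j.val + 1 = 2 then (1 : L) else 0) v).prod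
                (cmLocalIntegralLevel L 1 (Matrix.of fun i j : Fin 1 => if i.val + j.val + 1 = 1 then (1 : L) else 0) v) : Subgroup _) : Set _) : ℝ) : ℂ) * ((((Ideal.absNorm v.asIdeal : ℂ) ^ 2)⁻¹ * c' 0 + (((Ideal.absNorm v.asIdeal : ℂ) ^ 2 - 1) / (Ideal.absNorm v.asIdeal : ℂ) ^ 2) * c' 1))) +
          ((Ideal.absNorm v.asIdeal : ℕ) : ℂ)⁻¹ * (((νG.real (cmLocalIntegralLevel L 3 H' v : Set ((cmDatum L 3 H').Local v)) / νH.real (((cmLocalIntegralLevel L 2 (Matrix.of fun i j : Fin 2 => if i.val + j.val + 1 = 2 then (1 : L) else 0) v).prod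
                (cmLocalIntegralLevel L 1 (Matrix.of fun i j : Fin 1 => if i.val + j.val + 1 = 1 then (1 : L) else 0) v) : Subgroup _) : Set _) : ℝ) : ℂ) * (-((Ideal.absNorm v.asIdeal : ℂ))⁻¹ * c' 1 + (((Ideal.absNorm v.asIdeal : ℂ) + 1) / (Ideal.absNorm v.asIdeal : ℂ)) * c' 2)))) =
      (νG.real (cmLocalIntegralLevel L 3 H' v : Set ((cmDatum L 3 H').Local v)) / νH.real (((cmLocalIntegralLevel L 2 (Matrix.of fun i j : Fin 2 => if i.val + j.val + 1 = 2 then (1 : L) else 0) v).prod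
                (cmLocalIntegralLevel L 1 (Matrix.of fun i j : Fin 1 => if i.val + j.val + 1 = 1 then (1 : L) else 0) v) : Subgroup _) : Set _) : ℂ) *
        (Ideal.absNorm v.asIdeal : ℂ) * (c 2 * (1 - ((Ideal.absNorm v.asIdeal : ℂ) ^ 2)⁻¹) + c 1 * (((Ideal.absNorm v.asIdeal : ℂ) ^ 2)⁻¹ * (1 - (Ideal.absNorm v.asIdeal : ℂ)⁻¹)) +
          ((Ideal.absNorm v.asIdeal : ℂ) ^ 3)⁻¹ * (c' 2 * (1 - ((Ideal.absNorm v.asIdeal : ℂ) ^ 2)⁻¹) + c' 1 * (((Ideal.absNorm v.asIdeal : ℂ) ^ 2)⁻¹ * (1 - (Ideal.absNorm v.asIdeal : ℂ)⁻¹)) +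
            c' 0 * ((Ideal.absNorm v.asIdeal : ℂ) ^ 3)⁻¹)) := by
    rw [Complex.ofReal_div, hc0]
    generalize ((νG.real (cmLocalIntegralLevel L 3 H' v : Set ((cmDatum L 3 H').Local v)) : ℂ) /
      (νH.real (((cmLocalIntegralLevel L 2 (Matrix.of fun i j : Fin 2 => if i.val + j.val + 1 = 2 then (1 : L) else 0) v).prod
        (cmLocalIntegralLevel L 1 (Matrix.of fun i j : Fin 1 => if i.val + j.val + 1 = 1 then (1 : L) else 0) v) : Subgroup _) : Set _) : ℂ)) = r
    field_simp
    ring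
  -- the core, with the 2-deep predicate ((O1″) ★ p846644) and the level-two orbital value ((O2″) ★ p846625)
  exact finsum_delta_mul_classOrbitalIntegral_eq_of_levi_of_orbital_eq L H' μ hH' w hw hv hH'w hH'i hμ hμω νH νG hmH hmG g hg.continuous.measurable hginv
    (fun d => ∀ k : Fin 3, Valued.v ((((d k : (UnitaryGroup.LocalRing L v)ˣ) : UnitaryGroup.LocalRing L v) w) - 1) ≤ WithZero.exp (-2 : ℤ))
    (exists_nhds_one_forall_levi_twoDeep L v w) (fun _ hd i => valued_lt_one_of_le_exp_neg_two (hd i)) _ _ _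
    (by
      intro _ _ ψ hψK hψc T hT hψT μN _ t d hd hreg ha' hb' hdp γ₀ hγ₀
      exact classOrbitalIntegral_eq_mul_levelTwoStrata_of_torus_twoDeep L w hw H' hH'σ hH'd νG hmG ψ hψK hψc μN t hd hreg ha' hb' hγ₀
        g hg.continuous.measurable hginv T hT hψT hv h2w hdp hgK c c' hc hc')
    ha

end Literature.NumberTheory.Rogawski1990

end
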